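import Literature.Analysis.FluidPDE.OnsagerBDSVStationaryPhaseHolderBounds
import Literature.Analysis.FunctionSpaces.HolderScaleInterpolation
import HarnessLib

/-!
# BDSV stationary phase, VI: proof of Prop. C.2 for `ℛ` (`BDSV.antidivergencePhaseBound_holds`)

Buckmaster–De Lellis–Székelyhidi–Vicol, *Onsager's conjecture for admissible weak solutions*,
CPAM 72 (2019), App. C, Prop. C.2, second part:
`‖ℛ(a e^{ik·Φ})‖_α ≲ ‖a‖₀/|k|^{1-α} + (‖a‖_{N+α} + ‖a‖₀‖Φ‖_{N+α})/|k|^{N-α}`, "a simple consequence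
of classical stationary phase techniques" (Daneri–Székelyhidi 2017, Lemma 2.2 (ii)). This file
discharges the tree's transcription `BDSV.antidivergencePhaseBound`
(`OnsagerBDSVStationaryPhase.lean`) by assembling

* part III (`…Antidiv.lean`): the real telescoping identity and the Schauder step, in the form of
  `BDSV.antidivergence_phaseCos_smul_le_iterates₂` (part V): `‖ℛ(cos_θ a)‖_{0,α}` is bounded by
  `‖Lⁿa‖_∞`, `‖Lⁿa‖_{0,α}`, `n ≤ N`, with order-zero coefficients;
* part V (`…HolderBounds.lean`): the envelopes of `F` and of the iterates `Lⁿ a` in the geometric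
  bookkeeping `HolderEnvelope` of `FunctionSpaces/HolderEnvelope.lean`;
* the interpolation inequality (A.1) (`Torus.eContDiffHolderNorm_le_interp_of_le_one`), which puts
  the amplitude `a` and the phase gradient `∇D` into envelopes with rates `ρ_a`, `ρ` chosen so that
  `‖a‖₀ ρ_a^{N+α} = ‖a‖₀ + ‖a‖_{N,α}` and `(Ĉ+1) ρ^{N+α} = (Ĉ+1) + ‖∇D‖_{N,α}`
  (`BDSV.exists_interp_scale`, `BDSV.holderEnvelope_of_interp`) — this is where the estimate
  becomes TAME (linear in `‖a‖_{N,α}` and `‖D‖_{N+1,α}`);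
* the elementary comparison of the rates with `|m|` (`BDSV.rate_pow_le₁`–`rate_pow_le₄`: with
  `γ = max(ρ_a, ρ)`, every term is within `|m|^{α-1}‖a‖₀ + |m|^{α-N}‖a‖₀γ^{N+α}`, by the case
  distinction `γ ≶ |m|`), which is the "interpolation juggling" of De Lellis–Székelyhidi 2013,
  Prop. 5.2, referred to by Daneri–Székelyhidi.

The constant depends on `Ĉ`, `α`, `N` only, as printed.

## References

* T. Buckmaster, C. De Lellis, L. Székelyhidi Jr., V. Vicol, *Onsager's conjecture for admissible
  weak solutions*, CPAM 72 (2019) = arXiv:1701.08678, App. C, Prop. C.2; App. A (A.1)–(A.4).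
  [`BuckmasterEtAl2018`]
* S. Daneri, L. Székelyhidi Jr., *Non-uniqueness and h-principle for Hölder-continuous weak
  solutions of the Euler equations*, ARMA 224 (2017) = arXiv:1603.09714, Lemma 2.2 (ii), proof.
  [`DaneriSzekelyhidi2017`]
* C. De Lellis, L. Székelyhidi Jr., *Dissipative continuous Euler flows*, Invent. Math. 193
  (2013), Prop. 5.2 (proof). [`DeLellisSzekelyhidiInvent2013`]
-/

noncomputable section

open Set MeasureTheory Complex
open scoped NNReal ENNReal ContDiff InnerProductSpace

-- operator norms `‖B‖ₑ` of bilinear maps into spaces of linear maps need one more level of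
-- pending instance problems (as in `ContDiffHolderLeibniz.lean`, `HolderEnvelope.lean`)
set_option maxSynthPendingDepth 3

namespace Literature.Analysis.FluidPDE

namespace BDSV

open FunctionSpaces FunctionSpaces.Torus

/-- The flat three-torus `T³ = (ℝ/ℤ)³`, local notation. -/
local notation "𝕋³" => UnitAddTorus (Fin 3)

/-- Euclidean `ℝ³`, local notation. -/
local notation "ℝ³" => EuclideanSpace ℝ (Fin 3)

/-! ### The scale of interpolation -/

/-- **Choice of the interpolation scale**: for `p > 0`, `q ≥ 0`, `e > 0` there is `ε ∈ (0,1]`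
with `ε^e q ≤ p` and `p (ε⁻¹)^e = p + q` (namely `ε = (p/(p+q))^{1/e}`; with `p = ‖f‖₀`,
`q = ‖f‖_{N+α}`, `e = N + α` this is the scale at which (A.1) becomes (A.3)). [folklore] -/
theorem exists_interp_scale {p q e : ℝ} (hp : 0 < p) (hq : 0 ≤ q) (he : 0 < e) :
    ∃ ε : ℝ, 0 < ε ∧ ε ≤ 1 ∧ ε ^ e * q ≤ p ∧ p * ε⁻¹ ^ e = p + q := by
  have hpq : 0 < p + q := by linarith
  set x : ℝ := p / (p + q) with hx
  have hx0 : 0 < x := div_pos hp hpq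
  have hx1 : x ≤ 1 := (div_le_one hpq).2 (by linarith)
  refine ⟨x ^ e⁻¹, Real.rpow_pos_of_pos hx0 _, Real.rpow_le_one hx0.le hx1 (inv_nonneg.2 he.le),
    ?_, ?_⟩
  · rw [Real.rpow_inv_rpow hx0.le he.ne', hx, div_mul_eq_mul_div, div_le_iff₀ hpq]
    nlinarith
  · rw [Real.inv_rpow (Real.rpow_nonneg hx0.le _), Real.rpow_inv_rpow hx0.le he.ne', hx, inv_div,
      mul_div_cancel₀ _ hp.ne']

/-! ### Envelopes from the interpolation inequality (A.1) -/

/-- The interpolation constant `C_N = 5·9^{2^N-1}` of `Torus.eContDiffHolderNorm_le_interp_of_le_one`,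
cast from `ℝ≥0`. [folklore] -/
theorem interpConst_eq (N : ℕ) :
    ((5 * 9 ^ (2 ^ N - 1) : ℝ≥0) : ℝ≥0∞) = 5 * 9 ^ (2 ^ N - 1) := by push_cast; rfl

/-- **Envelope of a smooth periodic map from (A.1)**: if `‖f‖_∞ ≤ P` and
`ε^{N+α} ‖f‖_{N,α} ≤ P` (`0 < ε ≤ 1`), then `f̃` has the envelope
`(2 C_N P, 2 C_N P (ε⁻¹)^α, ε⁻¹)` to order `N` and exponent `α ≤ 1`. [folklore] -/
theorem holderEnvelope_of_interp {Y : Type} [NormedAddCommGroup Y] [NormedSpace ℝ Y]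
    {f : 𝕋³ → Y} (hf : IsSmooth f) {N : ℕ} {α : ℝ≥0} (hα : α ≤ 1) {ε : ℝ} (hε : 0 < ε)
    (hε1 : ε ≤ 1) {P : ℝ≥0∞} (hP : eSupNorm f ≤ P)
    (hPN : ENNReal.ofReal (ε ^ ((N : ℝ) + α)) * Torus.eContDiffHolderNorm N α f ≤ P) :
    HolderEnvelope (lift f) N α (2 * ((5 * 9 ^ (2 ^ N - 1) : ℝ≥0) : ℝ≥0∞) * P)
      (2 * ((5 * 9 ^ (2 ^ N - 1) : ℝ≥0) : ℝ≥0∞) * P * ENNReal.ofReal (ε⁻¹ ^ (α : ℝ)))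
      (ENNReal.ofReal ε⁻¹) := by
  have hinv1 : 1 ≤ ε⁻¹ := (one_le_inv₀ hε).2 hε1
  have hinv0 : 0 < ε⁻¹ := inv_pos.2 hε
  have hkey : ∀ {j : ℕ} {r' : ℝ≥0}, r' ≤ 1 → (j < N ∨ (j = N ∧ r' ≤ α)) →
      Torus.eContDiffHolderNorm j r' f ≤ 2 * ((5 * 9 ^ (2 ^ N - 1) : ℝ≥0) : ℝ≥0∞) * P *
        ENNReal.ofReal (ε ^ (-((j : ℝ) + r'))) := by
    intro j r' hr' hjk
    have h := Torus.eContDiffHolderNorm_le_interp_of_le_one hf hα hr' hjk hε hε1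
    refine h.trans ?_
    rw [interpConst_eq]
    calc 5 * 9 ^ (2 ^ N - 1) * ENNReal.ofReal (ε ^ (-((j : ℝ) + r'))) *
          (eSupNorm f + ENNReal.ofReal (ε ^ ((N : ℝ) + α)) * Torus.eContDiffHolderNorm N α f)
        ≤ 5 * 9 ^ (2 ^ N - 1) * ENNReal.ofReal (ε ^ (-((j : ℝ) + r'))) * (P + P) :=
          mul_le_mul' le_rfl (add_le_add hP hPN)
      _ = 2 * (5 * 9 ^ (2 ^ N - 1)) * P * ENNReal.ofReal (ε ^ (-((j : ℝ) + r'))) := by ring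
  refine ⟨hf, ?_, fun j hj => ?_, fun j hj => ?_⟩
  · rw [← ENNReal.ofReal_one]; exact ENNReal.ofReal_le_ofReal hinv1
  · have hjk : j < N ∨ (j = N ∧ (0 : ℝ≥0) ≤ α) := by
      rcases lt_or_eq_of_le hj with h | h
      · exact Or.inl h
      · exact Or.inr ⟨h, bot_le⟩
    refine (hkey zero_le_one hjk).trans (le_of_eq ?_)
    rw [NNReal.coe_zero, add_zero, Real.rpow_neg hε.le, ← Real.inv_rpow hε.le, Real.rpow_natCast,
      ENNReal.ofReal_pow hinv0.le]
  · have hjk : j < N ∨ (j = N ∧ α ≤ α) := by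
      rcases lt_or_eq_of_le hj with h | h
      · exact Or.inl h
      · exact Or.inr ⟨h, le_rfl⟩
    refine (hkey hα hjk).trans (le_of_eq ?_)
    rw [Real.rpow_neg hε.le, ← Real.inv_rpow hε.le, Real.rpow_add hinv0, Real.rpow_natCast,
      ENNReal.ofReal_mul (pow_nonneg hinv0.le _), ENNReal.ofReal_pow hinv0.le]
    ring

/-! ### Comparison of the rates with the frequency -/

section Rates

variable {M G : ℝ≥0∞} {a : ℝ} {N n : ℕ}

/-- `M⁻¹ ≤ 1` for `1 ≤ M`. [folklore] -/
theorem inv_le_one_of_one_le (hM1 : 1 ≤ M) : M⁻¹ ≤ 1 := ENNReal.inv_le_one.2 hM1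

/-- `M M⁻¹ = 1` for `1 ≤ M < ∞`. [folklore] -/
theorem mul_inv_cancel_of_one_le (hM1 : 1 ≤ M) (hMt : M ≠ ⊤) : M * M⁻¹ = 1 :=
  ENNReal.mul_inv_cancel (ne_of_gt (lt_of_lt_of_le zero_lt_one hM1)) hMt

/-- **Rates against the frequency, I**: for `1 ≤ M < ∞`, `1 ≤ G`, `0 < a` and `n ≤ N`,
`Gⁿ M^{-(n+1)} ≤ M⁻¹ + M^{-N} Gᴺ G^a` (cases `G ≤ M`: `(G/M)ⁿ ≤ 1`; `M ≤ G`: multiply by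
`(G/M)^{N-n} G^a ≥ 1`). [folklore] -/
theorem rate_pow_le₁ (hM1 : 1 ≤ M) (hMt : M ≠ ⊤) (hG1 : 1 ≤ G) (ha : 0 < a) (hn : n ≤ N) :
    G ^ n * M⁻¹ ^ (n + 1) ≤ M⁻¹ + M⁻¹ ^ N * G ^ N * G ^ a := by
  have hμ1 : M⁻¹ ≤ 1 := inv_le_one_of_one_le hM1
  have hGa : 1 ≤ G ^ a := ENNReal.one_le_rpow hG1 ha
  rcases le_total G M with h | h
  · -- `G ≤ M`
    have hGM : G * M⁻¹ ≤ 1 := by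
      calc G * M⁻¹ ≤ M * M⁻¹ := mul_le_mul' h le_rfl
        _ = 1 := mul_inv_cancel_of_one_le hM1 hMt
    calc G ^ n * M⁻¹ ^ (n + 1) = (G * M⁻¹) ^ n * M⁻¹ := by rw [mul_pow, pow_succ]; ring
      _ ≤ 1 ^ n * M⁻¹ := mul_le_mul' (pow_le_pow_left' hGM n) le_rfl
      _ = M⁻¹ := by rw [one_pow, one_mul]
      _ ≤ M⁻¹ + M⁻¹ ^ N * G ^ N * G ^ a := le_self_add
  · -- `M ≤ G`
    have hMG : 1 ≤ G * M⁻¹ := by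
      calc (1 : ℝ≥0∞) = M * M⁻¹ := (mul_inv_cancel_of_one_le hM1 hMt).symm
        _ ≤ G * M⁻¹ := mul_le_mul' h le_rfl
    calc G ^ n * M⁻¹ ^ (n + 1) = G ^ n * M⁻¹ ^ (n + 1) * 1 * 1 := by ring
      _ ≤ G ^ n * M⁻¹ ^ (n + 1) * (G * M⁻¹) ^ (N - n) * G ^ a :=
          mul_le_mul' (mul_le_mul' le_rfl (one_le_pow₀ hMG)) hGa
      _ = G ^ (n + (N - n)) * (M⁻¹ ^ (n + (N - n)) * M⁻¹) * G ^ a := by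
          rw [mul_pow, pow_add, pow_add, pow_succ]; ring
      _ = G ^ N * (M⁻¹ ^ N * M⁻¹) * G ^ a := by rw [Nat.add_sub_cancel' hn]
      _ ≤ G ^ N * (M⁻¹ ^ N * 1) * G ^ a := by gcongr
      _ = M⁻¹ ^ N * G ^ N * G ^ a := by ring
      _ ≤ M⁻¹ + M⁻¹ ^ N * G ^ N * G ^ a := le_add_self

/-- **Rates against the frequency, II**: for `1 ≤ M < ∞`, `1 ≤ G`, `0 < a` and `n + 1 ≤ N`,
`G^a Gⁿ M^{-(n+1)} ≤ M^a M⁻¹ + M^a M^{-N} Gᴺ G^a` (cases `G ≤ M`: `G^a ≤ M^a`; `M ≤ G`: as in I,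
then `1 ≤ M^a`). [folklore] -/
theorem rate_pow_le₂ (hM1 : 1 ≤ M) (hMt : M ≠ ⊤) (hG1 : 1 ≤ G) (ha : 0 < a) (hn : n + 1 ≤ N) :
    G ^ a * G ^ n * M⁻¹ ^ (n + 1) ≤ M ^ a * M⁻¹ + M ^ a * M⁻¹ ^ N * G ^ N * G ^ a := by
  have hμ1 : M⁻¹ ≤ 1 := inv_le_one_of_one_le hM1
  have hGa : 1 ≤ G ^ a := ENNReal.one_le_rpow hG1 ha
  have hMa : 1 ≤ M ^ a := ENNReal.one_le_rpow hM1 ha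
  rcases le_total G M with h | h
  · have hGM : G * M⁻¹ ≤ 1 := by
      calc G * M⁻¹ ≤ M * M⁻¹ := mul_le_mul' h le_rfl
        _ = 1 := mul_inv_cancel_of_one_le hM1 hMt
    calc G ^ a * G ^ n * M⁻¹ ^ (n + 1) = G ^ a * ((G * M⁻¹) ^ n * M⁻¹) := by
          rw [mul_pow, pow_succ]; ring
      _ ≤ M ^ a * (1 ^ n * M⁻¹) :=
          mul_le_mul' (ENNReal.rpow_le_rpow h ha.le) (mul_le_mul' (pow_le_pow_left' hGM n) le_rfl)
      _ = M ^ a * M⁻¹ := by rw [one_pow, one_mul]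
      _ ≤ _ := le_self_add
  · have hMG : 1 ≤ G * M⁻¹ := by
      calc (1 : ℝ≥0∞) = M * M⁻¹ := (mul_inv_cancel_of_one_le hM1 hMt).symm
        _ ≤ G * M⁻¹ := mul_le_mul' h le_rfl
    have hle : n ≤ N := Nat.le_of_succ_le hn
    calc G ^ a * G ^ n * M⁻¹ ^ (n + 1) = G ^ a * G ^ n * M⁻¹ ^ (n + 1) * 1 * 1 := by ring
      _ ≤ G ^ a * G ^ n * M⁻¹ ^ (n + 1) * (G * M⁻¹) ^ (N - n) * M ^ a :=
          mul_le_mul' (mul_le_mul' le_rfl (one_le_pow₀ hMG)) hMa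
      _ = G ^ a * G ^ (n + (N - n)) * (M⁻¹ ^ (n + (N - n)) * M⁻¹) * M ^ a := by
          rw [mul_pow, pow_add, pow_add, pow_succ]; ring
      _ = G ^ a * G ^ N * (M⁻¹ ^ N * M⁻¹) * M ^ a := by rw [Nat.add_sub_cancel' hle]
      _ ≤ G ^ a * G ^ N * (M⁻¹ ^ N * 1) * M ^ a := by gcongr
      _ = M ^ a * M⁻¹ ^ N * G ^ N * G ^ a := by ring
      _ ≤ _ := le_add_self

/-- **Rates against the frequency, III**: `M^a Gᴺ M^{-N} ≤ M^a M^{-N} Gᴺ G^a` (`1 ≤ G^a`). [folklore] -/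
theorem rate_pow_le₃ (hG1 : 1 ≤ G) (ha : 0 < a) :
    M ^ a * G ^ N * M⁻¹ ^ N ≤ M ^ a * M⁻¹ ^ N * G ^ N * G ^ a := by
  have hGa : 1 ≤ G ^ a := ENNReal.one_le_rpow hG1 ha
  calc M ^ a * G ^ N * M⁻¹ ^ N = M ^ a * M⁻¹ ^ N * G ^ N * 1 := by ring
    _ ≤ M ^ a * M⁻¹ ^ N * G ^ N * G ^ a := mul_le_mul' le_rfl hGa

/-- **Rates against the frequency, IV**: `G^a Gᴺ M^{-N} ≤ M^a M^{-N} Gᴺ G^a` (`1 ≤ M^a`). [folklore] -/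
theorem rate_pow_le₄ (hM1 : 1 ≤ M) (ha : 0 < a) :
    G ^ a * G ^ N * M⁻¹ ^ N ≤ M ^ a * M⁻¹ ^ N * G ^ N * G ^ a := by
  have hMa : 1 ≤ M ^ a := ENNReal.one_le_rpow hM1 ha
  calc G ^ a * G ^ N * M⁻¹ ^ N = 1 * (M⁻¹ ^ N * G ^ N * G ^ a) := by ring
    _ ≤ M ^ a * (M⁻¹ ^ N * G ^ N * G ^ a) := mul_le_mul' hMa le_rfl
    _ = _ := by ring

/-- `(max ρ₁ ρ₂)ᴺ (max ρ₁ ρ₂)^a ≤ ρ₁ᴺ ρ₁^a + ρ₂ᴺ ρ₂^a`. [folklore] -/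
theorem max_pow_mul_rpow_le (ρ₁ ρ₂ : ℝ≥0∞) (N : ℕ) (a : ℝ) :
    max ρ₁ ρ₂ ^ N * max ρ₁ ρ₂ ^ a ≤ ρ₁ ^ N * ρ₁ ^ a + ρ₂ ^ N * ρ₂ ^ a := by
  rcases le_total ρ₁ ρ₂ with h | h
  · rw [max_eq_right h]; exact le_add_self
  · rw [max_eq_left h]; exact le_self_add

end Rates

/-! ### The powers of `|m|` -/

section FreqPow

variable {m : Fin 3 → ℤ}

/-- `freqPow m s = (ofReal |m|)^s` for `m ≠ 0`. [folklore] -/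
theorem freqPow_eq_rpow (hm : m ≠ 0) (s : ℝ) :
    freqPow m s = ENNReal.ofReal ‖latticeVec m‖ ^ s := by
  rw [freqPow, ← norm_latticeVec_eq_sqrt, ENNReal.ofReal_rpow_of_pos (norm_latticeVec_pos hm)]

/-- `|m|^{-(1-α)} = |m|^α |m|⁻¹`. [folklore] -/
theorem freqPow_neg_one_sub (hm : m ≠ 0) (α : ℝ) :
    freqPow m (-(1 - α)) = ENNReal.ofReal ‖latticeVec m‖ ^ α * (ENNReal.ofReal ‖latticeVec m‖)⁻¹ := by
  have h0 : ENNReal.ofReal ‖latticeVec m‖ ≠ 0 :=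
    (ENNReal.ofReal_pos.2 (norm_latticeVec_pos hm)).ne'
  rw [freqPow_eq_rpow hm, show -(1 - α) = α + (-1 : ℝ) by ring,
    ENNReal.rpow_add _ _ h0 ENNReal.ofReal_ne_top, ENNReal.rpow_neg_one]

/-- `|m|^{-(N-α)} = |m|^α (|m|⁻¹)ᴺ`. [folklore] -/
theorem freqPow_neg_nat_sub (hm : m ≠ 0) (N : ℕ) (α : ℝ) :
    freqPow m (-((N : ℝ) - α)) =
      ENNReal.ofReal ‖latticeVec m‖ ^ α * (ENNReal.ofReal ‖latticeVec m‖)⁻¹ ^ N := by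
  have h0 : ENNReal.ofReal ‖latticeVec m‖ ≠ 0 :=
    (ENNReal.ofReal_pos.2 (norm_latticeVec_pos hm)).ne'
  rw [freqPow_eq_rpow hm, show -((N : ℝ) - α) = α + (-(N : ℝ)) by ring,
    ENNReal.rpow_add _ _ h0 ENNReal.ofReal_ne_top, ENNReal.rpow_neg, ENNReal.rpow_natCast,
    ← ENNReal.inv_pow]

end FreqPow

/-! ### The main estimate -/

section Main

variable {Ĉ : ℝ} {D : 𝕋³ → ℝ³} {m : Fin 3 → ℤ}

/-- The sup-amplitude of the phase gradient after interpolation: `A_g = 2 C_N (Ĉ + 1)`. [folklore] -/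
def gradAmp (Ĉ : ℝ) (N : ℕ) : ℝ≥0 := 2 * (5 * 9 ^ (2 ^ N - 1)) * Real.toNNReal (Ĉ + 1)

/-- `Torus.fderiv D` is smooth for smooth `D`. [folklore] -/
theorem isSmooth_torusFderiv' (hD : IsSmooth D) : IsSmooth (Torus.fderiv D) := by
  unfold IsSmooth
  rw [lift_fderiv_eq]
  exact hD.fderiv_right (m := ∞) (by exact_mod_cast le_top)

/-- `‖∇D‖_∞ ≤ Ĉ + 1` under non-degeneracy. [folklore] -/
theorem eSupNorm_torusFderiv_le (hND : IsNondegenerateDisplacement Ĉ D) :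
    eSupNorm (Torus.fderiv D) ≤ ENNReal.ofReal (Ĉ + 1) :=
  eSupNorm_le_ofReal fun x => norm_fderiv_le_of_isNondegenerate hND x

/-- **Level-zero bounds on the iterates.** Under the envelope hypotheses of part V (amplitude
`(A, H_a, γ)`, field `(A_F, A_F Θ, γ)`), for `n ≤ N`:
`‖Lⁿa‖_∞ ≤ A tⁿ` and `‖Lⁿa‖_{0,α} ≤ tⁿ (H_a + N A Θ)`, `t = K_L A_F γ`. [cite: DaneriSzekelyhidi2017, Lemma 2.2 (proof)] -/
theorem iterate_level_zero_le (hĈ : 1 ≤ Ĉ) (hD : IsSmooth D) (hND : IsNondegenerateDisplacement Ĉ D)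
    (hm : m ≠ 0) {a : 𝕋³ → ℝ³} (ha : IsSmooth a) {N : ℕ} {r : ℝ≥0} {γ A Ha AF Θ : ℝ≥0∞}
    (hA : HolderEnvelope (lift a) N r A Ha γ)
    (hF : ∀ l, HolderEnvelope (lift (ibpField m D l)) N r AF (AF * Θ) γ) {n : ℕ} (hn : n ≤ N) :
    eSupNorm ((ibpOpVec m D)^[n] a) ≤ A * (ibpOpConst N * AF * γ) ^ n ∧
      Torus.eContDiffHolderNorm 0 r ((ibpOpVec m D)^[n] a) ≤
        (ibpOpConst N * AF * γ) ^ n * (Ha + N * A * Θ) := by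
  have h := holderEnvelope_lift_iterate_ibpOpVec hĈ hD hND hm ha hA hF n hn
  refine ⟨?_, ?_⟩
  · rw [← eSupNorm_lift]; exact h.eSupNorm_le
  · refine h.norm_zero_r_le.trans (mul_le_mul' le_rfl ?_)
    gcongr

/-- **The `ℛ` estimate of Prop. C.2, for given operator and reciprocal constants.** For `Ĉ ≥ 1`,
`0 < α < 1`, `N ≥ 1`, constants `C_d`, `C_r` of `ℛ div`, `ℛ` on `C^{0,α}` and a constant `C_w` of the
reciprocal rule (order `N`, lower bound `Ĉ⁻²`, sup amplitude `K_s(N, A_g)`), there is `C` such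
that for all smooth non-degenerate `D`, `m ≠ 0`, `θ` and smooth `a`,
`‖ℛ(cos(ψ+θ) a)‖_{0,α} ≤ C (|m|^{-(1-α)}‖a‖_{0,0} + |m|^{-(N-α)}(‖a‖_{N,α} + ‖a‖_{0,0}‖D‖_{N+1,α}))`.
[cite: BuckmasterEtAl2018, App. C Prop. C.2] -/
theorem exists_antidivergence_phaseCos_smul_bound (hĈ : 1 ≤ Ĉ) {α : ℝ≥0} (hα0 : 0 < α)
    (hα1 : α < 1) {N : ℕ} (hN : 1 ≤ N) {Cd Cr Cw : ℝ≥0}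
    (hCd : ∀ A : 𝕋³ → Fin 3 → ℝ³, IsSmooth A →
      Torus.eContDiffHolderNorm 0 α (Torus.antidivergence (Torus.tensorDivergence A)) ≤
        Cd * Torus.eContDiffHolderNorm 0 α A)
    (hCr : ∀ v : 𝕋³ → ℝ³, IsSmooth v →
      Torus.eContDiffHolderNorm 0 α (Torus.antidivergence v) ≤ Cr * Torus.eContDiffHolderNorm 0 α v)
    (hCw : ∀ {s : ℝ³ → ℝ} {H' ρ' : ℝ≥0∞}, HolderEnvelope s N α (normSqConst N (gradAmp Ĉ N)) H' ρ' →
      (∀ y, (Ĉ ^ 2)⁻¹ ≤ s y) → HolderEnvelope (fun y => (s y)⁻¹) N α Cw (Cw * H') ρ') :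
    ∃ C : ℝ≥0, ∀ (D : 𝕋³ → ℝ³), IsSmooth D → IsNondegenerateDisplacement Ĉ D →
      ∀ m : Fin 3 → ℤ, m ≠ 0 → ∀ (θ : ℝ) (a : 𝕋³ → ℝ³), IsSmooth a →
        Torus.eContDiffHolderNorm 0 α (Torus.antidivergence fun x => phaseCos m D θ x • a x) ≤
          C * (freqPow m (-(1 - (α : ℝ))) * Torus.eContDiffHolderNorm 0 0 a +
            freqPow m (-((N : ℝ) - α)) *
              (Torus.eContDiffHolderNorm N α a +
                Torus.eContDiffHolderNorm 0 0 a * Torus.eContDiffHolderNorm (N + 1) α D)) := by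
  -- ### constants (independent of `D`, `m`, `θ`, `a`)
  have hC : 0 < Ĉ := lt_of_lt_of_le one_pos hĈ
  set Cint : ℝ≥0 := 5 * 9 ^ (2 ^ N - 1) with hCint
  set Pn : ℝ≥0 := Real.toNNReal (Ĉ + 1) with hPn
  have hPn1 : (1 : ℝ≥0∞) ≤ Pn := by
    rw [hPn, ← ENNReal.ofReal_one, ← ENNReal.ofReal_coe_nnreal, Real.coe_toNNReal _ (by linarith)]
    exact ENNReal.ofReal_le_ofReal (by linarith)
  set Ĉn : ℝ≥0 := Real.toNNReal Ĉ with hĈn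
  have hĈn : (Ĉn : ℝ≥0∞) = ENNReal.ofReal Ĉ := rfl
  set KF : ℝ≥0 := ibpFieldConst N (gradAmp Ĉ N) Cw with hKF
  set Knn : ℝ≥0 := 18 * (3 ^ (N + 1) * ((N : ℝ≥0) + 1 + 1)) with hKnn
  have hK : ibpOpConst N = (Knn : ℝ≥0∞) := by
    rw [hKnn, ibpOpConst]; push_cast; ring
  set c2π : ℝ≥0 := Real.toNNReal (2 * Real.pi)⁻¹ with hc2π
  set cT : ℝ≥0 := Knn * c2π * KF with hcT
  set cTN : ℝ≥0 := (cT + 1) ^ N with hcTN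
  have hcTn : ∀ n ≤ N, (cT : ℝ≥0∞) ^ n ≤ cTN := fun n hn => by
    rw [hcTN]; push_cast
    calc (cT : ℝ≥0∞) ^ n ≤ ((cT : ℝ≥0∞) + 1) ^ n := pow_le_pow_left' le_self_add n
      _ ≤ ((cT : ℝ≥0∞) + 1) ^ N := pow_le_pow_right₀ le_add_self hn
  set cH : ℝ≥0 := 2 * Cint * (1 + N * (1 + 2 * Cint * Pn)) with hcH
  set c23 : ℝ≥0 := Real.toNNReal (2 * Real.pi * Ĉ + 3) with hc23
  -- the five term constants and the total
  set k₁ : ℝ≥0 := c2π * Ĉn * cH * cTN with hk₁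
  set k₂ : ℝ≥0 := c2π * Ĉn * c23 * (2 * Cint) * cTN with hk₂
  set k₃ : ℝ≥0 := c2π * (Ĉn + 3 * Ĉn ^ 4 * (2 * Cint * Pn)) * (2 * Cint) * cTN with hk₃
  set k₄ : ℝ≥0 := cH * cTN with hk₄
  set k₅ : ℝ≥0 := c23 * (2 * Cint) * cTN with hk₅
  set Cbig : ℝ≥0 := (Cd * (N * (3 * (k₁ + k₂ + k₃))) + Cr * (k₄ + k₅)) * (2 + Pn) with hCbig
  refine ⟨Cbig, fun D hD hND m hm θ a ha => ?_⟩
  -- ### the frequency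
  set Mr : ℝ := ‖latticeVec m‖ with hMr
  have hMr1 : 1 ≤ Mr := one_le_norm_latticeVec hm
  have hMr0 : 0 < Mr := norm_latticeVec_pos hm
  set M : ℝ≥0∞ := ENNReal.ofReal Mr with hM
  have hM1 : 1 ≤ M := by rw [hM, ← ENNReal.ofReal_one]; exact ENNReal.ofReal_le_ofReal hMr1
  have hMt : M ≠ ⊤ := ENNReal.ofReal_ne_top
  have hμ1 : M⁻¹ ≤ 1 := inv_le_one_of_one_le hM1
  have hα0' : (0 : ℝ) < α := by exact_mod_cast hα0
  have hαle : α ≤ 1 := hα1.le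
  have hcM : ENNReal.ofReal (2 * Real.pi * Mr)⁻¹ = (c2π : ℝ≥0∞) * M⁻¹ := by
    rw [hc2π, hM, mul_inv, ENNReal.ofReal_mul (by positivity), ENNReal.ofReal_inv_of_pos hMr0]
    rfl
  have hfreqα : freqPow m α = M ^ (α : ℝ) := by rw [freqPow_eq_rpow hm, ← hMr, ← hM]
  have hfreq₁ : freqPow m (-(1 - (α : ℝ))) = M ^ (α : ℝ) * M⁻¹ := by
    rw [freqPow_neg_one_sub hm, ← hMr, ← hM]
  have hfreqN : freqPow m (-((N : ℝ) - α)) = M ^ (α : ℝ) * M⁻¹ ^ N := by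
    rw [freqPow_neg_nat_sub hm, ← hMr, ← hM]
  -- ### the trivial case `a = 0`
  by_cases ha0 : eSupNorm a = 0
  · have hzero : a = 0 := by
      funext x
      have hx : ‖a x‖ₑ = 0 := le_antisymm (ha0 ▸ enorm_le_eSupNorm a x) bot_le
      simpa using hx
    have hfun : (fun x => phaseCos m D θ x • a x) = 0 := by
      funext x; simp [hzero]
    rw [hfun, Torus.antidivergence_zero, Torus.eContDiffHolderNorm_zero_fun]
    exact bot_le
  -- ### sizes of `a` and of `∇D`
  set S₀ : ℝ≥0∞ := eSupNorm a with hS₀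
  set SN : ℝ≥0∞ := Torus.eContDiffHolderNorm N α a with hSN
  have hS₀t : S₀ ≠ ⊤ := ne_top_of_le_ne_top (ha.eContDiffHolderNorm_lt_top 0 (r := 0) zero_le_one).ne
    (eSupNorm_le_eContDiffHolderNorm_zero a 0)
  have hSNt : SN ≠ ⊤ := (ha.eContDiffHolderNorm_lt_top N hαle).ne
  set s₀ : ℝ := S₀.toReal with hs₀
  set sN : ℝ := SN.toReal with hsN
  have hs₀0 : 0 < s₀ := ENNReal.toReal_pos ha0 hS₀t
  have hS₀eq : S₀ = ENNReal.ofReal s₀ := (ENNReal.ofReal_toReal hS₀t).symm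
  have hSNeq : SN = ENNReal.ofReal sN := (ENNReal.ofReal_toReal hSNt).symm
  have he : (0 : ℝ) < N + α := by positivity
  obtain ⟨εa, hεa0, hεa1, hεaq, hεap⟩ := exists_interp_scale (q := sN) hs₀0 ENNReal.toReal_nonneg he
  -- the gradient
  have hgs : IsSmooth (Torus.fderiv D) := isSmooth_torusFderiv' hD
  set GN : ℝ≥0∞ := Torus.eContDiffHolderNorm N α (Torus.fderiv D) with hGN
  have hGNt : GN ≠ ⊤ := (hgs.eContDiffHolderNorm_lt_top N hαle).ne
  set gN : ℝ := GN.toReal with hgN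
  have hGNeq : GN = ENNReal.ofReal gN := (ENNReal.ofReal_toReal hGNt).symm
  have hP0 : (0 : ℝ) < Ĉ + 1 := by linarith
  obtain ⟨εg, hεg0, hεg1, hεgq, hεgp⟩ := exists_interp_scale (q := gN) hP0 ENNReal.toReal_nonneg he
  -- ### the envelopes of `a` and of `∇D`
  have hA := holderEnvelope_of_interp ha hαle hεa0 hεa1 (P := S₀) le_rfl (by
    rw [← hSN, hSNeq, ← ENNReal.ofReal_mul (by positivity), hS₀eq]
    exact ENNReal.ofReal_le_ofReal hεaq)
  have hg := holderEnvelope_of_interp hgs hαle hεg0 hεg1 (P := (Pn : ℝ≥0∞))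
    (by rw [hPn]; exact eSupNorm_torusFderiv_le hND) (by
      rw [← hGN, hGNeq, ← ENNReal.ofReal_mul (by positivity), hPn]
      exact ENNReal.ofReal_le_ofReal hεgq)
  set ρa : ℝ≥0∞ := ENNReal.ofReal εa⁻¹ with hρa
  set ρg : ℝ≥0∞ := ENNReal.ofReal εg⁻¹ with hρg
  set γ : ℝ≥0∞ := max ρa ρg with hγ
  have hγ1 : 1 ≤ γ := hA.one_le.trans (le_max_left _ _)
  have hρaα : ENNReal.ofReal (εa⁻¹ ^ (α : ℝ)) = ρa ^ (α : ℝ) := by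
    rw [hρa, ENNReal.ofReal_rpow_of_pos (inv_pos.2 hεa0)]
  have hρgα : ENNReal.ofReal (εg⁻¹ ^ (α : ℝ)) = ρg ^ (α : ℝ) := by
    rw [hρg, ENNReal.ofReal_rpow_of_pos (inv_pos.2 hεg0)]
  -- the payoff of the choice of scales
  have hpaya : S₀ * ρa ^ N * ρa ^ (α : ℝ) = S₀ + SN := by
    rw [hS₀eq, hSNeq, ← hρaα, hρa, ← ENNReal.ofReal_pow (inv_pos.2 hεa0).le,
      ← ENNReal.ofReal_mul hs₀0.le, ← ENNReal.ofReal_mul (by positivity),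
      ← ENNReal.ofReal_add hs₀0.le ENNReal.toReal_nonneg, ← hεap, mul_assoc, ← Real.rpow_natCast,
      ← Real.rpow_add (inv_pos.2 hεa0)]
  have hpayg : (Pn : ℝ≥0∞) * ρg ^ N * ρg ^ (α : ℝ) = Pn + GN := by
    rw [hPn, hGNeq, ← hρgα, hρg, ← ENNReal.ofReal_pow (inv_pos.2 hεg0).le,
      show ((Real.toNNReal (Ĉ + 1) : ℝ≥0) : ℝ≥0∞) = ENNReal.ofReal (Ĉ + 1) from rfl,
      ← ENNReal.ofReal_mul hP0.le, ← ENNReal.ofReal_mul (by positivity),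
      ← ENNReal.ofReal_add hP0.le ENNReal.toReal_nonneg, ← hεgp, mul_assoc, ← Real.rpow_natCast,
      ← Real.rpow_add (inv_pos.2 hεg0)]
  -- amplitudes
  set A : ℝ≥0∞ := 2 * (Cint : ℝ≥0∞) * S₀ with hAdef
  set Ha : ℝ≥0∞ := 2 * (Cint : ℝ≥0∞) * S₀ * ρa ^ (α : ℝ) with hHadef
  set Hg : ℝ≥0∞ := 2 * (Cint : ℝ≥0∞) * Pn * ρg ^ (α : ℝ) with hHgdef
  have hAγ : HolderEnvelope (lift a) N α A Ha γ := by
    have h := hA.rate_mono (le_max_left ρa ρg)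
    rw [hρaα] at h
    exact h
  have hgγ : HolderEnvelope (fderiv ℝ (lift D)) N α (gradAmp Ĉ N) Hg γ := by
    have h := hg.rate_mono (le_max_right ρa ρg)
    rw [hρgα, lift_fderiv_eq] at h
    refine h.mono le_rfl (le_of_eq ?_) le_rfl
    rw [gradAmp]; push_cast; ring
  -- ### the envelope of `F` and the level-zero bounds on the iterates
  have hF : ∀ l, HolderEnvelope (lift (ibpField m D l)) N α
      (ENNReal.ofReal (2 * Real.pi * ‖latticeVec m‖)⁻¹ * KF)
      (ENNReal.ofReal (2 * Real.pi * ‖latticeVec m‖)⁻¹ * KF * (1 + Hg)) γ := fun l =>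
    holderEnvelope_lift_ibpField hĈ hND hm hgγ hCw l
  set AF : ℝ≥0∞ := ENNReal.ofReal (2 * Real.pi * ‖latticeVec m‖)⁻¹ * KF with hAF
  set t : ℝ≥0∞ := ibpOpConst N * AF * γ with ht
  have hAFeq : AF = (c2π : ℝ≥0∞) * KF * M⁻¹ := by rw [hAF, ← hMr, hcM]; ring
  have hteq : t = (cT : ℝ≥0∞) * γ * M⁻¹ := by rw [ht, hAFeq, hK, hcT]; push_cast; ring
  have hlev : ∀ n, n ≤ N → eSupNorm ((ibpOpVec m D)^[n] a) ≤ A * t ^ n ∧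
      Torus.eContDiffHolderNorm 0 α ((ibpOpVec m D)^[n] a) ≤ t ^ n * (Ha + N * A * (1 + Hg)) :=
    fun n hn => iterate_level_zero_le hĈ hD hND hm ha hAγ hF hn
  -- ### auxiliary inequalities
  have hρaγ : ρa ^ (α : ℝ) ≤ γ ^ (α : ℝ) := ENNReal.rpow_le_rpow (le_max_left _ _) hα0'.le
  have hρgγ : ρg ^ (α : ℝ) ≤ γ ^ (α : ℝ) := ENNReal.rpow_le_rpow (le_max_right _ _) hα0'.le
  have hγα1 : 1 ≤ γ ^ (α : ℝ) := ENNReal.one_le_rpow hγ1 hα0'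
  have hHg_le : Hg ≤ 2 * (Cint : ℝ≥0∞) * Pn * γ ^ (α : ℝ) := mul_le_mul' le_rfl hρgγ
  have hHsum : Ha + N * A * (1 + Hg) ≤ (cH : ℝ≥0∞) * S₀ * γ ^ (α : ℝ) := by
    calc Ha + N * A * (1 + Hg)
        ≤ 2 * (Cint : ℝ≥0∞) * S₀ * γ ^ (α : ℝ) +
            N * (2 * (Cint : ℝ≥0∞) * S₀) * (1 * γ ^ (α : ℝ) + 2 * (Cint : ℝ≥0∞) * Pn * γ ^ (α : ℝ)) := by
          refine add_le_add (mul_le_mul' le_rfl hρaγ) (mul_le_mul' le_rfl (add_le_add ?_ hHg_le))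
          rw [one_mul]; exact hγα1
      _ = (cH : ℝ≥0∞) * S₀ * γ ^ (α : ℝ) := by rw [hcH]; push_cast; ring
  have hg0 : Torus.eContDiffHolderNorm 0 α (Torus.fderiv D) ≤ Hg := by
    have h := hgγ.norm_zero_r_le
    rwa [← lift_fderiv_eq] at h
  -- conversions of the coefficients
  have hX1 : ENNReal.ofReal ((2 * Real.pi * ‖latticeVec m‖)⁻¹ * Ĉ) = (c2π : ℝ≥0∞) * M⁻¹ * Ĉn := by
    rw [ENNReal.ofReal_mul (by positivity), ← hMr, hcM, hĈn]
  have hX3 : ENNReal.ofReal ((2 * Real.pi * ‖latticeVec m‖)⁻¹ * (3 * Ĉ ^ 4)) =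
      (c2π : ℝ≥0∞) * M⁻¹ * (3 * (Ĉn : ℝ≥0∞) ^ 4) := by
    rw [ENNReal.ofReal_mul (by positivity), ← hMr, hcM, ENNReal.ofReal_mul (by norm_num),
      ENNReal.ofReal_pow hC.le, ← hĈn, ENNReal.ofReal_ofNat]
  have hX4 : ENNReal.ofReal (2 * Real.pi * Ĉ + 3) * freqPow m α = (c23 : ℝ≥0∞) * M ^ (α : ℝ) := by
    rw [hfreqα]; rfl
  -- the target quantity of every term
  set RL : ℝ≥0∞ := M ^ (α : ℝ) * M⁻¹ + M ^ (α : ℝ) * M⁻¹ ^ N * γ ^ N * γ ^ (α : ℝ) with hRL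
  have hRL₁ : M ^ (α : ℝ) * (M⁻¹ + M⁻¹ ^ N * γ ^ N * γ ^ (α : ℝ)) = RL := by rw [hRL]; ring
  have hRL₂ : M ^ (α : ℝ) * M⁻¹ ^ N * γ ^ N * γ ^ (α : ℝ) ≤ RL := le_add_self
  -- ### the five terms
  have hT1 : ∀ n, n + 1 ≤ N →
      ENNReal.ofReal ((2 * Real.pi * ‖latticeVec m‖)⁻¹ * Ĉ) *
          Torus.eContDiffHolderNorm 0 α ((ibpOpVec m D)^[n] a) ≤ (k₁ : ℝ≥0∞) * (S₀ * RL) := by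
    intro n hn
    have hn' : n ≤ N := Nat.le_of_succ_le hn
    calc _ ≤ ((c2π : ℝ≥0∞) * M⁻¹ * Ĉn) * (t ^ n * (Ha + N * A * (1 + Hg))) := by
          rw [hX1]; exact mul_le_mul' le_rfl (hlev n hn').2
      _ ≤ ((c2π : ℝ≥0∞) * M⁻¹ * Ĉn) * (((cT : ℝ≥0∞) * γ * M⁻¹) ^ n * ((cH : ℝ≥0∞) * S₀ * γ ^ (α : ℝ))) := by
          rw [hteq]; exact mul_le_mul' le_rfl (mul_le_mul' le_rfl hHsum)
      _ = (c2π : ℝ≥0∞) * Ĉn * cH * (cT : ℝ≥0∞) ^ n * S₀ * (γ ^ (α : ℝ) * γ ^ n * M⁻¹ ^ (n + 1)) := by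
          rw [mul_pow, mul_pow, pow_succ]; ring
      _ ≤ (c2π : ℝ≥0∞) * Ĉn * cH * cTN * S₀ * RL :=
          mul_le_mul' (mul_le_mul' (mul_le_mul' le_rfl (hcTn n hn')) le_rfl)
            (rate_pow_le₂ hM1 hMt hγ1 hα0' hn)
      _ = (k₁ : ℝ≥0∞) * (S₀ * RL) := by rw [hk₁]; push_cast; ring
  have hT23 : ∀ n, n + 1 ≤ N →
      (ENNReal.ofReal ((2 * Real.pi * ‖latticeVec m‖)⁻¹ * Ĉ) *
            (ENNReal.ofReal (2 * Real.pi * Ĉ + 3) * freqPow m α) +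
          (ENNReal.ofReal ((2 * Real.pi * ‖latticeVec m‖)⁻¹ * Ĉ) +
            ENNReal.ofReal ((2 * Real.pi * ‖latticeVec m‖)⁻¹ * (3 * Ĉ ^ 4)) *
              Torus.eContDiffHolderNorm 0 α (Torus.fderiv D))) *
        eSupNorm ((ibpOpVec m D)^[n] a) ≤ ((k₂ : ℝ≥0∞) + k₃) * (S₀ * RL) := by
    intro n hn
    have hn' : n ≤ N := Nat.le_of_succ_le hn
    have hcoef : ENNReal.ofReal ((2 * Real.pi * ‖latticeVec m‖)⁻¹ * Ĉ) *
          (ENNReal.ofReal (2 * Real.pi * Ĉ + 3) * freqPow m α) +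
        (ENNReal.ofReal ((2 * Real.pi * ‖latticeVec m‖)⁻¹ * Ĉ) +
          ENNReal.ofReal ((2 * Real.pi * ‖latticeVec m‖)⁻¹ * (3 * Ĉ ^ 4)) *
            Torus.eContDiffHolderNorm 0 α (Torus.fderiv D)) ≤
        (c2π : ℝ≥0∞) * M⁻¹ * Ĉn * ((c23 : ℝ≥0∞) * M ^ (α : ℝ)) +
          (c2π : ℝ≥0∞) * M⁻¹ * ((Ĉn : ℝ≥0∞) + 3 * (Ĉn : ℝ≥0∞) ^ 4 * (2 * (Cint : ℝ≥0∞) * Pn)) * γ ^ (α : ℝ) := by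
      rw [hX1, hX3, hX4]
      refine add_le_add le_rfl ?_
      calc (c2π : ℝ≥0∞) * M⁻¹ * Ĉn + (c2π : ℝ≥0∞) * M⁻¹ * (3 * (Ĉn : ℝ≥0∞) ^ 4) *
            Torus.eContDiffHolderNorm 0 α (Torus.fderiv D)
          ≤ (c2π : ℝ≥0∞) * M⁻¹ * Ĉn * γ ^ (α : ℝ) +
              (c2π : ℝ≥0∞) * M⁻¹ * (3 * (Ĉn : ℝ≥0∞) ^ 4) * (2 * (Cint : ℝ≥0∞) * Pn * γ ^ (α : ℝ)) :=
            add_le_add (le_mul_of_one_le_right' hγα1) (mul_le_mul' le_rfl (hg0.trans hHg_le))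
        _ = _ := by ring
    calc _ ≤ ((c2π : ℝ≥0∞) * M⁻¹ * Ĉn * ((c23 : ℝ≥0∞) * M ^ (α : ℝ)) +
            (c2π : ℝ≥0∞) * M⁻¹ * ((Ĉn : ℝ≥0∞) + 3 * (Ĉn : ℝ≥0∞) ^ 4 * (2 * (Cint : ℝ≥0∞) * Pn)) *
              γ ^ (α : ℝ)) * (A * t ^ n) := mul_le_mul' hcoef (hlev n hn').1
      _ = (c2π : ℝ≥0∞) * Ĉn * c23 * (2 * Cint) * (cT : ℝ≥0∞) ^ n * S₀ *
              (M ^ (α : ℝ) * (γ ^ n * M⁻¹ ^ (n + 1))) +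
            (c2π : ℝ≥0∞) * ((Ĉn : ℝ≥0∞) + 3 * (Ĉn : ℝ≥0∞) ^ 4 * (2 * (Cint : ℝ≥0∞) * Pn)) * (2 * Cint) *
              (cT : ℝ≥0∞) ^ n * S₀ * (γ ^ (α : ℝ) * γ ^ n * M⁻¹ ^ (n + 1)) := by
          rw [hteq, hAdef, mul_pow, mul_pow, pow_succ]; ring
      _ ≤ (c2π : ℝ≥0∞) * Ĉn * c23 * (2 * Cint) * cTN * S₀ *
              (M ^ (α : ℝ) * (M⁻¹ + M⁻¹ ^ N * γ ^ N * γ ^ (α : ℝ))) +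
            (c2π : ℝ≥0∞) * ((Ĉn : ℝ≥0∞) + 3 * (Ĉn : ℝ≥0∞) ^ 4 * (2 * (Cint : ℝ≥0∞) * Pn)) * (2 * Cint) *
              cTN * S₀ * RL :=
          add_le_add
            (mul_le_mul' (mul_le_mul' (mul_le_mul' le_rfl (hcTn n hn')) le_rfl)
              (mul_le_mul' le_rfl (rate_pow_le₁ hM1 hMt hγ1 hα0' hn')))
            (mul_le_mul' (mul_le_mul' (mul_le_mul' le_rfl (hcTn n hn')) le_rfl)
              (rate_pow_le₂ hM1 hMt hγ1 hα0' hn))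
      _ = ((k₂ : ℝ≥0∞) + k₃) * (S₀ * RL) := by rw [hRL₁, hk₂, hk₃]; push_cast; ring
  have hT4 : Torus.eContDiffHolderNorm 0 α ((ibpOpVec m D)^[N] a) ≤ (k₄ : ℝ≥0∞) * (S₀ * RL) := by
    calc _ ≤ t ^ N * (Ha + N * A * (1 + Hg)) := (hlev N le_rfl).2
      _ ≤ ((cT : ℝ≥0∞) * γ * M⁻¹) ^ N * ((cH : ℝ≥0∞) * S₀ * γ ^ (α : ℝ)) := by
          rw [hteq]; exact mul_le_mul' le_rfl hHsum
      _ = (cH : ℝ≥0∞) * (cT : ℝ≥0∞) ^ N * S₀ * (γ ^ (α : ℝ) * γ ^ N * M⁻¹ ^ N) := by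
          rw [mul_pow, mul_pow]; ring
      _ ≤ (cH : ℝ≥0∞) * cTN * S₀ * RL :=
          mul_le_mul' (mul_le_mul' (mul_le_mul' le_rfl (hcTn N le_rfl)) le_rfl)
            ((rate_pow_le₄ hM1 hα0').trans hRL₂)
      _ = (k₄ : ℝ≥0∞) * (S₀ * RL) := by rw [hk₄]; push_cast; ring
  have hT5 : ENNReal.ofReal (2 * Real.pi * Ĉ + 3) * freqPow m α * eSupNorm ((ibpOpVec m D)^[N] a) ≤
      (k₅ : ℝ≥0∞) * (S₀ * RL) := by
    calc _ ≤ (c23 : ℝ≥0∞) * M ^ (α : ℝ) * (A * t ^ N) := by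
          rw [hX4]; exact mul_le_mul' le_rfl (hlev N le_rfl).1
      _ = (c23 : ℝ≥0∞) * (2 * Cint) * (cT : ℝ≥0∞) ^ N * S₀ * (M ^ (α : ℝ) * γ ^ N * M⁻¹ ^ N) := by
          rw [hteq, hAdef, mul_pow, mul_pow]; ring
      _ ≤ (c23 : ℝ≥0∞) * (2 * Cint) * cTN * S₀ * RL :=
          mul_le_mul' (mul_le_mul' (mul_le_mul' le_rfl (hcTn N le_rfl)) le_rfl)
            ((rate_pow_le₃ hγ1 hα0').trans hRL₂)
      _ = (k₅ : ℝ≥0∞) * (S₀ * RL) := by rw [hk₅]; push_cast; ring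
  -- ### the payoff: `S₀ RL` against the target
  have hW : S₀ * γ ^ N * γ ^ (α : ℝ) ≤ S₀ + SN + S₀ * (Pn + GN) := by
    calc S₀ * γ ^ N * γ ^ (α : ℝ) = S₀ * (γ ^ N * γ ^ (α : ℝ)) := by ring
      _ ≤ S₀ * (ρa ^ N * ρa ^ (α : ℝ) + ρg ^ N * ρg ^ (α : ℝ)) :=
          mul_le_mul' le_rfl (max_pow_mul_rpow_le ρa ρg N α)
      _ = S₀ * ρa ^ N * ρa ^ (α : ℝ) + S₀ * (1 * ρg ^ N * ρg ^ (α : ℝ)) := by ring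
      _ ≤ (S₀ + SN) + S₀ * ((Pn : ℝ≥0∞) * ρg ^ N * ρg ^ (α : ℝ)) := by
          rw [hpaya]; exact add_le_add le_rfl (mul_le_mul' le_rfl (mul_le_mul' (mul_le_mul' hPn1 le_rfl) le_rfl))
      _ = S₀ + SN + S₀ * (Pn + GN) := by rw [hpayg]
  have hμN : M⁻¹ ^ N ≤ M⁻¹ := by
    obtain ⟨k, hk⟩ := Nat.exists_eq_add_of_le hN
    rw [hk, pow_add, pow_one]
    calc M⁻¹ * M⁻¹ ^ k ≤ M⁻¹ * 1 := mul_le_mul' le_rfl (pow_le_one₀ bot_le hμ1)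
      _ = M⁻¹ := mul_one _
  have hS₀' : S₀ ≤ Torus.eContDiffHolderNorm 0 0 a := eSupNorm_le_eContDiffHolderNorm_zero a 0
  have hGD : GN ≤ Torus.eContDiffHolderNorm (N + 1) α D := Torus.eContDiffHolderNorm_fderiv_le N α D
  have hTT : S₀ * RL ≤ (2 + (Pn : ℝ≥0∞)) * (M ^ (α : ℝ) * M⁻¹ * Torus.eContDiffHolderNorm 0 0 a +
      M ^ (α : ℝ) * M⁻¹ ^ N * (SN + Torus.eContDiffHolderNorm 0 0 a *
        Torus.eContDiffHolderNorm (N + 1) α D)) := by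
    calc S₀ * RL = M ^ (α : ℝ) * M⁻¹ * S₀ + M ^ (α : ℝ) * M⁻¹ ^ N * (S₀ * γ ^ N * γ ^ (α : ℝ)) := by
          rw [hRL]; ring
      _ ≤ M ^ (α : ℝ) * M⁻¹ * S₀ + M ^ (α : ℝ) * M⁻¹ ^ N * (S₀ + SN + S₀ * (Pn + GN)) :=
          add_le_add le_rfl (mul_le_mul' le_rfl hW)
      _ = M ^ (α : ℝ) * M⁻¹ * S₀ + M ^ (α : ℝ) * M⁻¹ ^ N * S₀ * (1 + Pn) +
            M ^ (α : ℝ) * M⁻¹ ^ N * (SN + S₀ * GN) := by ring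
      _ ≤ M ^ (α : ℝ) * M⁻¹ * S₀ + M ^ (α : ℝ) * M⁻¹ * S₀ * (1 + Pn) +
            M ^ (α : ℝ) * M⁻¹ ^ N * (SN + S₀ * GN) := by
          gcongr
      _ = (2 + (Pn : ℝ≥0∞)) * (M ^ (α : ℝ) * M⁻¹ * S₀) + M ^ (α : ℝ) * M⁻¹ ^ N * (SN + S₀ * GN) := by ring
      _ ≤ (2 + (Pn : ℝ≥0∞)) * (M ^ (α : ℝ) * M⁻¹ * S₀) +
            (2 + (Pn : ℝ≥0∞)) * (M ^ (α : ℝ) * M⁻¹ ^ N * (SN + S₀ * GN)) :=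
          add_le_add le_rfl (le_mul_of_one_le_left' (le_add_right one_le_two))
      _ = (2 + (Pn : ℝ≥0∞)) * (M ^ (α : ℝ) * M⁻¹ * S₀ + M ^ (α : ℝ) * M⁻¹ ^ N * (SN + S₀ * GN)) := by ring
      _ ≤ _ := by gcongr
  -- ### assembly
  have hred := antidivergence_phaseCos_smul_le_iterates₂ hĈ hD hND hm θ ha hαle hCd hCr N
  refine hred.trans ?_
  calc _ ≤ (Cd : ℝ≥0∞) * ∑ n ∈ Finset.range N, ∑ _l : Fin 3,
            ((k₁ : ℝ≥0∞) * (S₀ * RL) + ((k₂ : ℝ≥0∞) + k₃) * (S₀ * RL)) +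
          Cr * ((k₄ : ℝ≥0∞) * (S₀ * RL) + (k₅ : ℝ≥0∞) * (S₀ * RL)) := by
        refine add_le_add (mul_le_mul' le_rfl (Finset.sum_le_sum fun n hn =>
          Finset.sum_le_sum fun l _ => add_le_add (hT1 n (Finset.mem_range.1 hn)) ?_)) ?_
        · exact hT23 n (Finset.mem_range.1 hn)
        · exact mul_le_mul' le_rfl (add_le_add hT4 hT5)
    _ = ((Cd : ℝ≥0∞) * (N * (3 * ((k₁ : ℝ≥0∞) + k₂ + k₃))) + Cr * ((k₄ : ℝ≥0∞) + k₅)) * (S₀ * RL) := by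
        simp only [Finset.sum_const, Finset.card_range, Finset.card_univ, Fintype.card_fin,
          nsmul_eq_mul]
        push_cast; ring
    _ ≤ ((Cd : ℝ≥0∞) * (N * (3 * ((k₁ : ℝ≥0∞) + k₂ + k₃))) + Cr * ((k₄ : ℝ≥0∞) + k₅)) *
          ((2 + (Pn : ℝ≥0∞)) * (M ^ (α : ℝ) * M⁻¹ * Torus.eContDiffHolderNorm 0 0 a +
            M ^ (α : ℝ) * M⁻¹ ^ N * (SN + Torus.eContDiffHolderNorm 0 0 a *
              Torus.eContDiffHolderNorm (N + 1) α D))) := mul_le_mul' le_rfl hTT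
    _ = _ := by rw [hCbig, hfreq₁, hfreqN]; push_cast; ring

/-! ### The discharge -/

/-- **BDSV App. C, Prop. C.2 for `ℛ` — discharge of `BDSV.antidivergencePhaseBound`.** For
`Ĉ ≥ 1`, `0 < α < 1`, `N ≥ 1` there is `C = C(Ĉ, α, N)` such that for every smooth displacement `D`
with `Ĉ⁻¹|v| ≤ |(Id + ∇D)v| ≤ Ĉ|v|`, every `m ∈ ℤ³ ∖ {0}`, `θ ∈ ℝ` and smooth `a : T³ → ℝ³`,
`‖ℛ(cos(2π m·Φ + θ) a)‖_{C^{0,α}} ≤ C (|m|^{-(1-α)} ‖a‖_{C⁰} + |m|^{-(N-α)} (‖a‖_{C^{N,α}} + ‖a‖_{C⁰} ‖D‖_{C^{N+1,α}}))`,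
`Φ = id + D`. Printed source: Buckmaster–De Lellis–Székelyhidi–Vicol 2019, App. C, Prop. C.2
("`‖ℛ(a e^{ik·Φ})‖_α ≲ ‖a‖₀/|k|^{1-α} + (‖a‖_{N+α} + ‖a‖₀‖Φ‖_{N+α})/|k|^{N-α}`, where the implicit
constant depends on `Ĉ`, `α` and `N`, but not on `k`"), proved as in Daneri–Székelyhidi 2017,
Lemma 2.2 (ii): telescoping integration by parts along `∇φ/|∇φ|²` (part III), Schauder bounds for
`ℛ`, `ℛ div` (`BDSV.holderCZBound_holds`), tame bounds on the iterates (parts V–VI).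
[cite: BuckmasterEtAl2018, App. C Prop. C.2] -/
theorem antidivergencePhaseBound_holds : antidivergencePhaseBound := by
  intro Ĉ hĈ α hα0 hα1 N hN
  obtain ⟨Cd, hCd⟩ := holder_antidivergence_tensorDivergence_le holderCZBound_holds hα0 hα1
  obtain ⟨Cr, hCr⟩ := holder_antidivergence_le holderCZBound_holds hα0 hα1
  have hC : 0 < Ĉ := lt_of_lt_of_le one_pos hĈ
  have hc : (0 : ℝ) < (Ĉ ^ 2)⁻¹ := by positivity
  obtain ⟨Cw, hCw⟩ := HolderEnvelope.inv (E := ℝ³) N hc (normSqConst N (gradAmp Ĉ N)) α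
  obtain ⟨C, hC⟩ := exists_antidivergence_phaseCos_smul_bound hĈ hα0 hα1 hN hCd hCr
    (fun hs hcs => hCw hs hcs)
  exact ⟨C, hC⟩

end Main

end BDSV

end Literature.Analysis.FluidPDE
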